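import Mathlib
import HarnessLib
import Summits.Ventures.LatticeQCDFlow.Exactness.FlowPushforward

/-!
# Jacobian of a kernel through a measure-presenting chart: if `Φ(x, y)` presents `μ` from `μ ⊗ D·ν` and `h` acts as `f` on the fibre coordinate, then `h` has Jacobian `J` with `J(Φ(x,y))·D(y) = J_f(y)·D(f y)` — the shape of the Haar–Vandermonde factor

HONEST FRAMING: exact (Metropolis-corrected) sampling algorithms for lattice gauge theory;
figures of merit are autocorrelation/cost numbers at stated couplings and volumes; no
continuum-physics claim.

Venture `LatticeQCDFlow` (cell pub-lqcd), topic `Exactness`; FANOUT row 10 (`eng-equiv`, engine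
`latflow.equiv`, `spectral.py`: "the log-det of the spectral kernel w.r.t. Haar is the log-det of
the eigenvalue map plus `log |Δ(f λ)|² − log |Δ(λ)|²` (Haar/Vandermonde factor)"; `flows_jax.
spectral_jax`).  NEW WORK of the cell over row 30's `FlowPushforward.HasJacobian`; pure measure
theory; nothing is cited as a fact; no number; no definition is introduced.  Printed
counterparts, NAMED ONLY: Boyda et al., PRD 103 (2021) 074504, eq. (19) (density of the spectral
flow = density on the eigenvalues × the ratio of Vandermonde factors) and App. A; the Weyl
integration formula (Bröcker–tom Dieck IV (1.11)) is the intended INSTANCE of the hypothesis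
`hW` below (chart `Φ(g, t) = g t g⁻¹` on `U(n) × T`, `D = |Δ|²/n!`) and is NOT asserted here.

## The mechanism (pure measure theory; `X`, `Y` measurable spaces, `μ`, `ν` s-finite)

Data: a measurable "chart" `Φ : X × Y → X` and a measurable density `D : Y → [0, ∞]` that
PRESENT `μ`:  `Φ_* (μ ⊗ D·ν) = μ` (hypothesis `hW`; for `U(n)`: conjugation presents Haar from
Haar × Vandermonde-weighted torus Haar).  A fibre map `f : Y → Y` with `HasJacobian ν f J_f`,
and a measurable `h : X → X` INTERTWINED with it, `h (Φ (x, y)) = Φ (x, f y)` (for `U(n)`: the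
spectral kernel, `h(g t g⁻¹) = g f(t) g⁻¹`).  A measurable candidate Jacobian `J : X → [0, ∞]`
satisfying, on the image of the chart, the multiplicative identity
`J (Φ (x, y)) · D y = J_f y · D (f y)` (for `U(n)`: `J = J_f · |Δ ∘ f|² / |Δ|²`, Boyda (19);
written without division, so degenerate fibres need no exception).

* `withDensity_map_eq_map_withDensity_comp` — `(Φ_* ρ)·J = Φ_* (ρ · (J ∘ Φ))`;
* **`hasJacobian_of_chart`** — CONCLUSION: `HasJacobian μ h J`.  Proof:
  `h_* (J·μ) = h_* Φ_* ((J∘Φ)·(μ ⊗ D·ν)) = Φ_* (id × f)_* (μ ⊗ (J∘Φ · D)·ν)`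
  `= Φ_* (μ ⊗ f_* ((J_f · D∘f)·ν)) = Φ_* (μ ⊗ D·ν) = μ`, using the intertwining, the identity for
  `J`, `HasJacobian.map_withDensity` for `f`, and `hW` twice;
* `hasJacobian_of_chart_inter` — the same with the identity for `J` assumed only for `y` in a
  measurable set `S ⊆ Y` of full `ν`-measure that `f` preserves (the regular fibres), `J`
  arbitrary elsewhere.

With `SpectralCouplingMeasurable.hasJacobian_spectralCouplingLayer_of_kernelJacobian` this
leaves, for end-to-end exactness of the engine's `SU(N)` spectral coupling layer, exactly two
inputs: the Weyl presentation `hW` of Haar on `SU(N)` / `U(N)` (a published theorem, to be cited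
under `Literature/`) and the eigenvalue map's own Jacobian on the torus (`HasJacobian ν f J_f`,
the box-spline certificate).

NOT here: the Weyl integration formula itself; any number.
-/

noncomputable section

namespace Summit.Ventures.LatticeQCDFlow.Exactness

open MeasureTheory Measure
open scoped ENNReal

variable {X Y : Type*} [MeasurableSpace X] [MeasurableSpace Y]

/-- **Density after pushforward = pushforward of the pulled-back density**:
`(Φ_* ρ)·J = Φ_* (ρ·(J ∘ Φ))` for measurable `Φ`, `J`. -/
theorem withDensity_map_eq_map_withDensity_comp {α : Type*} [MeasurableSpace α] {ρ : Measure α}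
    {Φ : α → X} (hΦ : Measurable Φ) {J : X → ℝ≥0∞} (hJ : Measurable J) :
    (Measure.map Φ ρ).withDensity J = Measure.map Φ (ρ.withDensity (J ∘ Φ)) := by
  ext s hs
  rw [withDensity_apply _ hs, Measure.map_apply hΦ hs, withDensity_apply _ (hΦ hs),
    setLIntegral_map hs hJ hΦ]
  rfl

/-- **Jacobian through a measure-presenting chart.**  `Φ : X × Y → X` and `D : Y → [0,∞]`
present `μ` (`Φ_* (μ ⊗ D·ν) = μ`); `f : Y → Y` has Jacobian `J_f` for `ν`; `h : X → X` is
measurable and intertwined, `h (Φ (x, y)) = Φ (x, f y)`; `J` is measurable with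
`J (Φ (x, y)) · D y = J_f y · D (f y)`.  Then `h` has Jacobian `J` for `μ`: `h_* (J·μ) = μ`. -/
theorem hasJacobian_of_chart {μ : Measure X} {ν : Measure Y} [SFinite μ] [SFinite ν]
    {Φ : X × Y → X} (hΦ : Measurable Φ) {D : Y → ℝ≥0∞} (hD : Measurable D)
    (hW : Measure.map Φ (μ.prod (ν.withDensity D)) = μ)
    {f : Y → Y} {Jf : Y → ℝ≥0∞} (hf : HasJacobian ν f Jf)
    {h : X → X} (hh : Measurable h) (hinter : ∀ x y, h (Φ (x, y)) = Φ (x, f y))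
    {J : X → ℝ≥0∞} (hJm : Measurable J) (hJ : ∀ x y, J (Φ (x, y)) * D y = Jf y * D (f y)) :
    HasJacobian μ h J where
  measurable := hh
  measurable_jac := hJm
  map_eq := by
    have hfm : Measurable f := hf.measurable
    have hJfm : Measurable Jf := hf.measurable_jac
    have hPm : Measurable (Prod.map (id : X → X) f) := measurable_id.prodMap hfm
    -- the density pulled back along the chart does not see `x` (after the Vandermonde weight)
    have hdens : (μ.prod (ν.withDensity D)).withDensity (J ∘ Φ) =
        μ.prod (ν.withDensity fun y => D (f y) * Jf y) := by
      have hm : Measurable fun z : X × Y => D z.2 := hD.comp measurable_snd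
      have hm2 : Measurable fun y : Y => D (f y) * Jf y := (hD.comp hfm).mul hJfm
      rw [prod_withDensity_right hD, prod_withDensity_right hm2, ← withDensity_mul _ hm (hJm.comp hΦ)]
      congr 1
      funext q
      simp only [Pi.mul_apply, Function.comp_apply]
      rw [mul_comm, hJ q.1 q.2, mul_comm]
    -- the intertwining, as an identity of maps on `X × Y`
    have hcomp : h ∘ Φ = Φ ∘ Prod.map id f := by
      funext q
      obtain ⟨x, y⟩ := q
      simp only [Function.comp_apply, Prod.map_apply, id_eq]
      exact hinter x y
    calc Measure.map h (μ.withDensity J)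
        = Measure.map h ((Measure.map Φ (μ.prod (ν.withDensity D))).withDensity J) := by rw [hW]
      _ = Measure.map h (Measure.map Φ ((μ.prod (ν.withDensity D)).withDensity (J ∘ Φ))) := by
          rw [withDensity_map_eq_map_withDensity_comp hΦ hJm]
      _ = Measure.map (h ∘ Φ) ((μ.prod (ν.withDensity D)).withDensity (J ∘ Φ)) :=
          Measure.map_map hh hΦ
      _ = Measure.map (Φ ∘ Prod.map id f) (μ.prod (ν.withDensity fun y => D (f y) * Jf y)) := by
          rw [hcomp, hdens]
      _ = Measure.map Φ (Measure.map (Prod.map id f)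
            (μ.prod (ν.withDensity fun y => D (f y) * Jf y))) := (Measure.map_map hΦ hPm).symm
      _ = Measure.map Φ ((Measure.map id μ).prod
            (Measure.map f (ν.withDensity fun y => D (f y) * Jf y))) := by
          rw [Measure.map_prod_map _ _ measurable_id hfm]
      _ = Measure.map Φ (μ.prod (ν.withDensity D)) := by
          rw [Measure.map_id, hf.map_withDensity hD]
      _ = μ := hW

/-- A Jacobian may be changed on a null set: if `J_f = J_f'` `ν`-a.e. then
`HasJacobian ν f J_f → HasJacobian ν f J_f'` (measurability of `J_f'` required). -/
theorem HasJacobian.congr_ae {ν : Measure Y} {f : Y → Y} {Jf Jf' : Y → ℝ≥0∞}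
    (hf : HasJacobian ν f Jf) (hJf' : Measurable Jf') (hae : Jf =ᵐ[ν] Jf') :
    HasJacobian ν f Jf' where
  measurable := hf.measurable
  measurable_jac := hJf'
  map_eq := by rw [← withDensity_congr_ae hae, hf.map_eq]

/-- **The same with the Jacobian identity only on the regular fibres.**  If the identity
`J (Φ (x, y)) · D y = J_f y · D (f y)` is known only for `y` in a measurable set `S` of full
`ν`-measure which `f` maps into itself (for `U(n)`: the regular torus points, off the diagonals
`t_i = t_j`, which a bijective permutation-equivariant eigenvalue map preserves), the conclusion
still holds — `J` may be anything on the singular fibres.  (Apply `hasJacobian_of_chart` to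
`𝟙_S D` and `𝟙_S J_f`, which present the same measures.) -/
theorem hasJacobian_of_chart_inter {μ : Measure X} {ν : Measure Y} [SFinite μ] [SFinite ν]
    {Φ : X × Y → X} (hΦ : Measurable Φ) {D : Y → ℝ≥0∞} (hD : Measurable D)
    (hW : Measure.map Φ (μ.prod (ν.withDensity D)) = μ)
    {f : Y → Y} {Jf : Y → ℝ≥0∞} (hf : HasJacobian ν f Jf)
    {h : X → X} (hh : Measurable h) (hinter : ∀ x y, h (Φ (x, y)) = Φ (x, f y))
    {J : X → ℝ≥0∞} (hJm : Measurable J) {S : Set Y} (hS : MeasurableSet S) (hSν : ν Sᶜ = 0)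
    (hfS : Set.MapsTo f S S) (hJ : ∀ x, ∀ y ∈ S, J (Φ (x, y)) * D y = Jf y * D (f y)) :
    HasJacobian μ h J := by
  classical
  have hae : ∀ᵐ y ∂ν, y ∈ S := by
    rw [ae_iff]
    simpa only [Set.mem_compl_iff, Set.compl_def] using hSν
  -- `𝟙_S D` presents the same measure
  have hD'm : Measurable (S.indicator D) := hD.indicator hS
  have hDD' : ν.withDensity (S.indicator D) = ν.withDensity D := by
    refine withDensity_congr_ae ?_
    filter_upwards [hae] with y hy
    exact Set.indicator_of_mem hy D
  have hW' : Measure.map Φ (μ.prod (ν.withDensity (S.indicator D))) = μ := by rw [hDD', hW]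
  -- `𝟙_S J_f` is still a Jacobian of `f`
  have hf' : HasJacobian ν f (S.indicator Jf) :=
    hf.congr_ae (hf.measurable_jac.indicator hS) (by
      filter_upwards [hae] with y hy
      exact (Set.indicator_of_mem hy Jf).symm)
  refine hasJacobian_of_chart hΦ hD'm hW' hf' hh hinter hJm fun x y => ?_
  by_cases hy : y ∈ S
  · rw [Set.indicator_of_mem hy, Set.indicator_of_mem hy, Set.indicator_of_mem (hfS hy)]
    exact hJ x y hy
  · rw [Set.indicator_of_notMem hy, Set.indicator_of_notMem hy, mul_zero, zero_mul]

end Summit.Ventures.LatticeQCDFlow.Exactness
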